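import Summits.Ventures.WeilGRH.DualTrigKernelSound
import HarnessLib

/-!
# Format D-K soundness, part 9: one certificate = the KEY-GROUP FAMILY over every modulus `q ≥ q₀`

Cell `rh-explicit`, WEIL TRACK — GRH ARM, route B (weil-grh-3).  The modulus `q` enters the twisted
finite-prime Weil weight

  `M_{χ,N}(τ) = Re ψ(1/4 + a_χ/2 + iτ/2) + (log q − log π) − ρ_{χ,N}(τ)`

(`weilFinitePrimeWeightChar`) ONLY through the additive constant `+ log q` and through the vanishing
of `χ(n)` at the prime powers `n ≤ N` not coprime to `q`; the ripple `ρ_{χ,N}` depends on `χ` only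
through the values `χ(n)`, `n ≤ N`.  Hence a format-D-K certificate `c` checked at the threshold
modulus `c.q = q₀` — which certifies `0 ≤ Re ψ + (log q₀ − log π) + Σ (window terms) + T(τ)` on `ℝ`
— proves the multiplier inequality, and therefore the rung `WeilPositivityOnChar χ (log (N+1) / 2)`,
for EVERY Dirichlet character `χ` of ANY modulus `q ≥ q₀` with parity `c.par`, the claimed values
`χ(n) = e^{2πi u/v}` at the listed prime powers, and `χ(n) = 0` at the prime powers `n ≤ N` that are
not coprime to `q₀` (the KEY GROUP of the certificate; the last condition is automatic when `q₀` is
coprime to every prime `≤ N`, and is the hypothesis "`p ∣ q`" otherwise):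

* `DKCert.Pθ_nonneg_of_check` — the certificate function `P(θ) = Re ψ(σ' + iρθ) + (log q₀ − log π) +
  Σ_t val_t(θ)` is `≥ 0` on `ℝ` (this is steps (1)–(3) of `DKCert.sound`, recorded as a lemma);
* `DKCert.sound_family` — the multiplier inequality `0 ≤ M_{χ,N}(τ) + T(τ)` for the whole key group,
  every modulus `q ≥ q₀`;
* `DKCert.weilPositivityOnChar_family_of_check` — the rung for the whole key group, every modulus
  `q ≥ q₀` (the production form "one theorem per key group with a log q-threshold" of the arm's A2
  table: `ε*(q′, key) = ε*(q, key) + log(q′/q)` exactly).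

Everything here is PROVED; no named facts, no `sorry`, no kernel evaluation.

## References

* A. Weil, *Sur les "formules explicites" de la théorie des nombres premiers* (1952), (11) pp. 261–262
  (the conductor enters through `log(q/π)·F(0)` only). [folklore consequences]
-/

noncomputable section

open Finset Real Complex

namespace Summit.Ventures.WeilGRH

open Literature.Analysis.ValidatedNumerics.NumericsMP
open Literature.NumberTheory.LFunctions
open DualTrigTaylor DigammaVertical
open scoped ArithmeticFunction.vonMangoldt

namespace DKCert

variable {c : DKCert}

/-! ### The certificate function is nonnegative on `ℝ` -/

/-- **The certificate function is `≥ 0` everywhere.**  If `c.check = true` then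
`0 ≤ P(θ) = Re ψ(σ' + iρθ) + (log c.q − log π) + Σ_t val_t(θ)` for every real `θ` (cells on the covered
range, evenness / the tail inequality outside).  Steps (1)–(3) of `DKCert.sound`. [folklore] -/
theorem Pθ_nonneg_of_check (hc : c.check = true) (θ : ℝ) : 0 ≤ c.Pθ θ := by
  -- unpack the check
  unfold check frameOK at hc
  simp only [Bool.and_eq_true] at hc
  obtain ⟨⟨⟨⟨⟨⟨hconsts, hvals⟩, hnodup⟩, hblocks⟩, hatoms⟩, htail⟩, hcells⟩ := hc
  obtain ⟨hS, hp0, hD, _, hR, _, hpi, hlog, hrho, hC⟩ := constsOK_sound hconsts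
  obtain ⟨hρ, hρω⟩ := rhoR_pos_and_mul hp0 hD
  have hF := terms_repr hS hpi hlog hp0 hvals
  have hSr : (0 : ℝ) < c.S := by exact_mod_cast hS
  obtain ⟨hbs, hchain, b0, bl, h0, hl, hfirst, hlast⟩ := blocksOK_sound hblocks
  have hb0 : b0 ∈ c.blocks := List.mem_of_mem_head? h0
  have hbl : bl ∈ c.blocks := List.mem_of_mem_getLast? hl
  have hMc0 : (0 : ℝ) < b0.Mc := by exact_mod_cast (hbs b0 hb0).1
  have hMcl : (0 : ℝ) < bl.Mc := by exact_mod_cast (hbs bl hbl).1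
  have hend : π ≤ bEnd bl := by
    unfold bEnd; rw [le_div_iff₀ hMcl]
    have : (bl.Mc : ℝ) ≤ 2 * ((bl.j0 : ℝ) + bl.n) := by exact_mod_cast hlast
    nlinarith [Real.pi_pos]
  have hstart0 : bStart b0 ≤ 0 := by
    unfold bStart
    have : (b0.j0 : ℝ) ≤ 0 := by
      split_ifs at hfirst with he
      · exact_mod_cast hfirst
      · have : (2 * b0.j0 : ℝ) ≤ -(b0.Mc : ℝ) := by exact_mod_cast hfirst
        linarith
    have : 2 * π * (b0.j0 : ℝ) ≤ 0 := by nlinarith [Real.pi_pos]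
    exact div_nonpos_of_nonpos_of_nonneg this hMc0.le
  -- (1) the periodic part everywhere
  have hint : ∀ rt ∈ cList c.terms c.termsR, ∃ k : ℤ, rt.κ = k :=
    cList_int c.terms c.termsR hF isInt_of_comm
  have hT : ∀ θ : ℝ, (c.mT : ℝ) / c.S ≤ sumVal (cList c.terms c.termsR) θ := by
    intro θ
    set k : ℤ := ⌊(θ + π) / (2 * π)⌋ with hk
    set θ' : ℝ := θ - k * (2 * π) with hθ'
    have h2π : (0 : ℝ) < 2 * π := by positivity
    have hθ'1 : -π ≤ θ' := by
      have := Int.floor_le ((θ + π) / (2 * π))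
      rw [← hk, le_div_iff₀ h2π] at this; rw [hθ']; linarith
    have hθ'2 : θ' ≤ π := by
      have := Int.lt_floor_add_one ((θ + π) / (2 * π))
      rw [← hk, div_lt_iff₀ h2π] at this; rw [hθ']; linarith
    have hper : sumVal (cList c.terms c.termsR) θ = sumVal (cList c.terms c.termsR) θ' := by
      rw [hθ', show θ - k * (2 * π) = θ + (-k : ℤ) * (2 * π) by push_cast; ring]
      exact (sumVal_add_int_mul _ hint θ (-k)).symm
    rw [hper]
    by_cases he : c.even = true
    · have hevenB : ∀ t ∈ cList c.terms c.termsR, t.B = 0 :=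
        fun t ht ↦ termsR_B_zero hvals he t (mem_of_mem_cList _ _ t ht)
      rcases le_total 0 θ' with hpos | hneg
      · exact T_ge_of_covered hS hpi hrho hρ hC hR hF hblocks hcells h0 hl (hstart0.trans hpos)
          (hθ'2.trans hend) hθ'1 hθ'2
      · rw [← sumVal_neg _ hevenB θ']
        exact T_ge_of_covered hS hpi hrho hρ hC hR hF hblocks hcells h0 hl (by linarith) (by linarith)
          (by linarith) (by linarith)
    · have hstartπ : bStart b0 ≤ -π := by
        rw [Bool.not_eq_true] at he; simp only [he] at hfirst
        unfold bStart; rw [div_le_iff₀ hMc0]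
        have : (2 * b0.j0 : ℝ) ≤ -(b0.Mc : ℝ) := by exact_mod_cast hfirst
        nlinarith [Real.pi_pos]
      exact T_ge_of_covered hS hpi hrho hρ hC hR hF hblocks hcells h0 hl (hstartπ.trans hθ'1)
        (hθ'2.trans hend) hθ'1 hθ'2
  -- (2) the tail
  have hnc : ∀ θ : ℝ, -(((c.bInc : ℤ) : ℝ) / c.S) ≤ sumVal (ncList c.terms c.termsR) θ := by
    intro θ
    have h1 := neg_sum_abs_le_sumVal (ncList c.terms c.termsR) θ
    have h2 := ncList_abs_le hS c.terms c.termsR hF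
    unfold bInc
    linarith
  unfold tailOK at htail
  simp only [h0, hl, Bool.and_eq_true, Bool.or_eq_true] at htail
  obtain ⟨htl, htf⟩ := htail
  have tail_of : ∀ (Mc : ℕ) (jj : ℤ), 1 ≤ Mc →
      (match c.psiTailLo Mc jj with | some v => decide (0 ≤ v + c.constI.lo - c.bInc + c.mT) | none => false) = true →
      ∀ θ : ℝ, 2 * π * |(jj : ℝ)| / Mc ≤ |θ| → 0 ≤ c.Pθ θ := by
    intro Mc jj hMc h θ hθ
    cases hv : c.psiTailLo Mc jj with
    | none => simp [hv] at h
    | some v =>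
      simp only [hv, decide_eq_true_eq] at h
      have hψ := psiTailLo_sound hS hpi hrho hρ hMc jj hv hθ
      have hCr : ((c.constI.lo : ℤ) : ℝ) / c.S ≤ c.constR := lo_le hS hC
      have hsplit : sumVal c.termsR θ = sumVal (cList c.terms c.termsR) θ + sumVal (ncList c.terms c.termsR) θ := by
        rw [sumVal_cList c.terms c.termsR hF θ]; ring
      have hz : (0 : ℝ) ≤ ((v + c.constI.lo - c.bInc + c.mT : ℤ) : ℝ) / c.S := by
        have : (0 : ℝ) ≤ ((v + c.constI.lo - c.bInc + c.mT : ℤ) : ℝ) := by exact_mod_cast h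
        positivity
      unfold Pθ; rw [hsplit]
      push_cast at hz
      have := hT θ; have := hnc θ
      rw [add_div, sub_div, add_div] at hz
      linarith
  -- (3) every θ: first for θ ≥ bStart b0
  have hge : ∀ θ : ℝ, bStart b0 ≤ θ → 0 ≤ c.Pθ θ := by
    intro θ hθ
    rcases le_total θ (bEnd bl) with hle | hgt
    · exact Pθ_nonneg_of_covered hS hpi hrho hρ hC hR hF hblocks hcells h0 hl hθ hle
    · refine tail_of bl.Mc (bl.j0 + bl.n) (hbs bl hbl).1 htl θ ?_
      have hjj : (0 : ℝ) ≤ ((bl.j0 + bl.n : ℤ) : ℝ) := by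
        have : 0 < bEnd bl := lt_of_lt_of_le Real.pi_pos hend
        unfold bEnd at this
        have := (div_pos_iff_of_pos_right hMcl).1 this
        push_cast; nlinarith [Real.pi_pos]
      rw [abs_of_nonneg hjj]
      have : bEnd bl = 2 * π * ((bl.j0 + bl.n : ℤ) : ℝ) / bl.Mc := by unfold bEnd; push_cast; ring
      rw [← this]
      exact hgt.trans (le_abs_self θ)
  rcases le_total (bStart b0) θ with hθ | hθ
  · exact hge θ hθ
  · by_cases he : c.even = true
    · rw [← Pθ_neg hvals he θ]
      exact hge (-θ) (by linarith)
    · rw [Bool.not_eq_true] at he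
      simp only [he, Bool.false_eq_true, false_or] at htf
      refine tail_of b0.Mc b0.j0 (hbs b0 hb0).1 htf θ ?_
      simp only [he, Bool.false_eq_true, if_false] at hfirst
      have hj0 : (b0.j0 : ℝ) ≤ 0 := by
        have : (2 * b0.j0 : ℝ) ≤ -(b0.Mc : ℝ) := by exact_mod_cast hfirst
        linarith
      rw [abs_of_nonpos hj0]
      have hθ0 : θ ≤ 0 := hθ.trans hstart0
      rw [abs_of_nonpos hθ0]
      unfold bStart at hθ
      have : 2 * π * -(b0.j0 : ℝ) / b0.Mc = -(2 * π * b0.j0 / b0.Mc) := by ring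
      rw [this]; linarith

/-! ### The window terms for a character of ANY modulus taking the claimed values -/

section anyModulus

variable {q : ℕ} {χ : DirichletCharacter ℂ q}

/-- One window term evaluates to minus the corresponding summand of the ripple, for `χ` of any
modulus taking the claimed value at `n`. [folklore] -/
theorem valR_val_family (hp0 : 2 ≤ c.p0) (hD : 1 ≤ c.D) {val : DKVal} (hp : Nat.Prime val.p) (he : 1 ≤ val.e)
    (hpe : val.p ^ val.e = val.n) (hχ : χ (val.n : ZMod q) = valZ val) (τ : ℝ) :
    (c.valR val).val (c.omegaR * τ) =
      -((Λ val.n : ℝ) / Real.sqrt val.n * (2 * ((χ (val.n : ZMod q)).re * Real.cos (τ * Real.log val.n) +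
        (χ (val.n : ZMod q)).im * Real.sin (τ * Real.log val.n)))) := by
  have hp0r : (1 : ℝ) < c.p0 := by exact_mod_cast hp0
  have hlogp0 : Real.log c.p0 ≠ 0 := (Real.log_pos hp0r).ne'
  have hDr : (c.D : ℝ) ≠ 0 := by exact_mod_cast (show c.D ≠ 0 by omega)
  have hΛ : (Λ val.n : ℝ) = Real.log val.p := by
    rw [← hpe, ArithmeticFunction.vonMangoldt_apply_pow (by omega), ArithmeticFunction.vonMangoldt_apply_prime hp]
  have hfreq : (c.valR val).κ * (c.omegaR * τ) = τ * Real.log val.n := by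
    simp only [valR, omegaR]; field_simp
  rw [hχ, RTerm.val, hfreq, hΛ]
  simp only [valR, div_eq_mul_inv]
  ring

/-- The ripple summand at `n` vanishes if `n` is not a prime power or `χ(n) = 0` (`χ` of any modulus).
[folklore] -/
theorem ripple_summand_eq_zero {τ : ℝ} {n : ℕ} (h : ¬ IsPrimePow n ∨ χ (n : ZMod q) = 0) :
    (Λ n : ℝ) / Real.sqrt n * (2 * ((χ (n : ZMod q)).re * Real.cos (τ * Real.log n) +
      (χ (n : ZMod q)).im * Real.sin (τ * Real.log n))) = 0 := by
  rcases h with hpp | hz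
  · rw [ArithmeticFunction.vonMangoldt_eq_zero_iff.2 hpp]; simp
  · simp [hz]

/-- **The window terms evaluate to minus the twisted prime ripple** for `χ` of ANY modulus `q` taking
the claimed values at the listed prime powers and vanishing at the prime powers `n ≤ N` not coprime to
the threshold modulus `c.q`: `sumVal (vals.map valR) (ωτ) = −weilPrimeRippleChar χ N τ`. [folklore] -/
theorem sumVal_valsR_eq_family (hp0 : 2 ≤ c.p0) (hD : 1 ≤ c.D) (hvals : c.valsOK = true)
    (hnodup : (c.vals.map (·.n)).Nodup)
    (hχ : ∀ val ∈ c.vals, χ (val.n : ZMod q) = valZ val)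
    (hχ0 : ∀ n : ℕ, n ≤ c.N → IsPrimePow n → ¬ Nat.Coprime n c.q → χ (n : ZMod q) = 0) (τ : ℝ) :
    sumVal (c.vals.map c.valR) (c.omegaR * τ) = -weilPrimeRippleChar χ c.N τ := by
  -- the ripple summand, for brevity
  set F : ℕ → ℝ := fun n ↦ (Λ n : ℝ) / Real.sqrt n * (2 * ((χ (n : ZMod q)).re * Real.cos (τ * Real.log n) +
    (χ (n : ZMod q)).im * Real.sin (τ * Real.log n))) with hFdef
  -- both sides as sums of `F` over the listed `n`
  have h1 : sumVal (c.vals.map c.valR) (c.omegaR * τ) = -((c.vals.map (·.n)).map F).sum := by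
    have : ∀ vs : List DKVal, (∀ v ∈ vs, v ∈ c.vals) →
        sumVal (vs.map c.valR) (c.omegaR * τ) = -((vs.map (·.n)).map F).sum := by
      intro vs
      induction vs with
      | nil => simp
      | cons v vs ih =>
          intro hmem
          obtain ⟨hp, he, hpe, -⟩ := valsOK_val hvals (hmem v (by simp))
          rw [List.map_cons, sumVal_cons, ih (fun w hw ↦ hmem w (by simp [hw])),
            valR_val_family hp0 hD hp he hpe (hχ v (hmem v (by simp))) τ]
          simp [hFdef]; ring
    exact this c.vals fun v hv ↦ hv
  rw [h1]
  unfold weilPrimeRippleChar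
  rw [show (∑ n ∈ range (c.N + 1), (Λ n : ℝ) / Real.sqrt n * (2 * ((χ (n : ZMod q)).re *
      Real.cos (τ * Real.log n) + (χ (n : ZMod q)).im * Real.sin (τ * Real.log n)))) =
      ∑ n ∈ range (c.N + 1), F n from rfl]
  rw [← List.sum_toFinset _ hnodup]
  congr 1
  apply Finset.sum_subset
  · intro n hn
    rw [List.mem_toFinset, List.mem_map] at hn
    obtain ⟨v, hv, rfl⟩ := hn
    exact Finset.mem_range.2 (by have := (valsOK_val hvals hv).2.2.2.1; omega)
  · intro n hn hnot
    apply ripple_summand_eq_zero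
    by_cases hpp : IsPrimePow n
    · right
      by_cases hco : Nat.Coprime n c.q
      · -- coverage check of `valsOK`: a prime power `n ≤ N` coprime to `c.q` is listed
        exfalso
        have hvals' := hvals
        unfold valsOK at hvals'
        simp only [Bool.and_eq_true] at hvals'
        obtain ⟨⟨⟨_, _⟩, hcov⟩, _⟩ := hvals'
        rw [List.all_eq_true] at hcov
        have hc' := hcov n (List.mem_range.2 (Finset.mem_range.1 hn))
        rw [Bool.or_eq_true, Bool.or_eq_true] at hc'
        rcases hc' with (h1 | h2) | h3
        · rw [List.any_eq_true] at h1
          obtain ⟨v, hv, hvn⟩ := h1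
          rw [beq_iff_eq] at hvn
          exact hnot (List.mem_toFinset.2 (List.mem_map.2 ⟨v, hv, hvn⟩))
        · have hc2 : coprimeB n c.q = true := (coprimeB_iff n c.q).2 hco
          rw [hc2] at h2; exact absurd h2 (by decide)
        · have hc3 : isPrimePowB n = true := isPrimePowB_of_isPrimePow hpp
          rw [hc3] at h3; exact absurd h3 (by decide)
      · exact hχ0 n (by have := Finset.mem_range.1 hn; omega) hpp hco
    · left; exact hpp

end anyModulus

/-! ### The family theorems -/

/-- `log c.q ≤ log q` for naturals `c.q ≤ q`. [folklore] -/
theorem log_threshold_le {q : ℕ} (hq : c.q ≤ q) : Real.log (c.q : ℝ) ≤ Real.log (q : ℝ) := by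
  rcases Nat.eq_zero_or_pos c.q with h0 | hpos
  · rw [h0, Nat.cast_zero, Real.log_zero]; exact Real.log_natCast_nonneg q
  · exact Real.log_le_log (by exact_mod_cast hpos) (by exact_mod_cast hq)

/-- **Soundness for the whole key group, every modulus `q ≥ c.q`.**  If `c.check = true`, then for every
modulus `q ≥ c.q` and every Dirichlet character `χ` mod `q` of parity `c.par` taking the claimed values
`χ(n) = e^{2πi u/v}` at the listed prime powers and vanishing at the prime powers `n ≤ N` not coprime to
`c.q`, the multiplier inequality `0 ≤ M_{χ,N}(τ) + Σ_k (a_k cos(kωτ) + b_k sin(kωτ))` holds for every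
real `τ` (the modulus contributes `+ log q ≥ + log c.q`). [folklore] -/
theorem sound_family (hc : c.check = true) {q : ℕ} (hq : c.q ≤ q) (χ : DirichletCharacter ℂ q)
    (hpar : charParity χ = c.par) (hχ : ∀ val ∈ c.vals, χ (val.n : ZMod q) = valZ val)
    (hχ0 : ∀ n : ℕ, n ≤ c.N → IsPrimePow n → ¬ Nat.Coprime n c.q → χ (n : ZMod q) = 0) (τ : ℝ) :
    0 ≤ weilFinitePrimeWeightChar χ c.N τ + trigSum (c.atoms.map c.atomT) τ := by
  have hmain := Pθ_nonneg_of_check hc (c.omegaR * τ)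
  unfold check frameOK at hc
  simp only [Bool.and_eq_true] at hc
  obtain ⟨⟨⟨⟨⟨⟨hconsts, hvals⟩, hnodup⟩, _⟩, _⟩, _⟩, _⟩ := hc
  obtain ⟨_, hp0, hD, _, _, _, _, _, _, _⟩ := constsOK_sound hconsts
  obtain ⟨_, hρω⟩ := rhoR_pos_and_mul hp0 hD
  unfold Pθ at hmain
  have hval := sumVal_valsR_eq_family (χ := χ) hp0 hD hvals (by
    unfold valsNodup at hnodup; simpa using hnodup) hχ hχ0 τ
  unfold termsR at hmain
  rw [sumVal_append, sumVal_atoms, hval] at hmain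
  unfold weilFinitePrimeWeightChar
  have harg : (c.sigR : ℂ) + ((c.rhoR * (c.omegaR * τ) : ℝ) : ℂ) * I =
      1 / 4 + (charParity χ : ℂ) / 2 + (τ : ℂ) / 2 * I := by
    rw [← mul_assoc, hρω, hpar]
    unfold sigR
    push_cast; ring
  rw [harg] at hmain
  unfold constR at hmain
  have hlog := log_threshold_le (c := c) hq
  linarith

/-- **The rung for the whole key group, every modulus `q ≥ c.q`.**  If `c.check = true`, then for every
modulus `q ≥ c.q`, `q ≠ 1`, and every Dirichlet character `χ` mod `q` of parity `c.par` with the claimed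
window values `χ(n) = e^{2πi u/v}` at the listed prime powers and `χ(n) = 0` at the prime powers `n ≤ N`
not coprime to `c.q`: `WeilPositivityOnChar χ (log (c.N + 1) / 2)` — Weil positivity of `L(s, χ)` for all
smooth test functions supported in `[−log(N+1)/2, log(N+1)/2]`.  One kernel certificate = one theorem
for the key group at every conductor above the threshold. [folklore] -/
theorem weilPositivityOnChar_family_of_check (hc : c.check = true) {q : ℕ} (hq : c.q ≤ q) (hq1 : q ≠ 1)
    (χ : DirichletCharacter ℂ q) (hpar : charParity χ = c.par)
    (hχ : ∀ val ∈ c.vals, χ (val.n : ZMod q) = valZ val)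
    (hχ0 : ∀ n : ℕ, n ≤ c.N → IsPrimePow n → ¬ Nat.Coprime n c.q → χ (n : ZMod q) = 0) :
    WeilPositivityOnChar χ (Real.log ((c.N : ℝ) + 1) / 2) := by
  refine weilPositivityOnChar_of_trigDual hq1 χ c.N (c.atoms.map c.atomT) ?_ (sound_family hc hq χ hpar hχ hχ0)
  -- admissibility of the atoms from `atomsOK`
  have hc' := hc
  unfold check frameOK at hc'
  simp only [Bool.and_eq_true] at hc'
  obtain ⟨⟨⟨⟨⟨⟨hconsts, _⟩, _⟩, _⟩, hatoms⟩, _⟩, _⟩ := hc'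
  obtain ⟨_, hp0, hD, -⟩ := constsOK_sound hconsts
  intro A hA
  rw [List.mem_map] at hA
  obtain ⟨atm, hatm, rfl⟩ := hA
  unfold atomsOK at hatoms
  rw [List.all_eq_true] at hatoms
  have h := hatoms atm hatm
  rw [decide_eq_true_eq] at h
  simp only [atomT, omegaR]
  have hp0r : (1 : ℝ) < c.p0 := by exact_mod_cast hp0
  have hDr : (0 : ℝ) < c.D := by exact_mod_cast hD
  have hN1 : (0 : ℝ) < (c.N : ℝ) + 1 := by positivity
  have hreal : ((c.N : ℝ) + 1) ^ c.D ≤ (c.p0 : ℝ) ^ atm.k := by exact_mod_cast h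
  have hlogle := Real.log_le_log (by positivity) hreal
  rw [Real.log_pow, Real.log_pow] at hlogle
  rw [← mul_div_assoc, le_div_iff₀ hDr]
  linarith

/-- When the threshold modulus `c.q` is coprime to every `n ≤ N` with `2 ≤ n` (no prime `≤ N` divides
`c.q`), the vanishing hypothesis of the family theorems is vacuous. [folklore] -/
theorem hχ0_of_coprime_window {q : ℕ} (χ : DirichletCharacter ℂ q)
    (hcop : ∀ n : ℕ, 2 ≤ n → n ≤ c.N → Nat.Coprime n c.q) :
    ∀ n : ℕ, n ≤ c.N → IsPrimePow n → ¬ Nat.Coprime n c.q → χ (n : ZMod q) = 0 := by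
  intro n hn hpp hco
  exact absurd (hcop n hpp.two_le hn) hco

end DKCert

end Summit.Ventures.WeilGRH

end
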